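import Summits.ABC.ABC.Theses.IsogenyGlueCongruence
import Summits.ABC.ABC.Theorems.IsogenyGlueCongruenceSemistableHeightPolyBoundResidual
import HarnessLib

/-!
# Route `IsogenyGlueCongruence`, support item `SemistableHeightPolyBound` (stmt-ABC-13918) —
# the isogeny-class transfer it needs is only LOG-QUADRATIC

In the route's deciding theorem (rev 19) the crude height bound `SemistableHeightPolyBound`
(`∃ c, h_F(E) ≤ c · N_E²` for semistable `E/ℚ` in global minimal form) is produced as
`hHofMK hMK hMod` from the two known-in-print, formally-XL items `MazurKenkuBound`
(stmt-ABC-15125: the minimal parametrisation degree of a globally minimal curve of the class is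
`≤ 163 · δ_{1,N}`; Mazur 1978 Thm 1 — Eisenstein ideal — and Kenku 1982) and `ModularDatumExists`
(stmt-ABC-15126), and these two items enter `closes` ONLY there. This helper records that the
Mazur–Kenku input is used far below its strength: the derivation needs the transfer from the
class-minimal degree `δ_{1,N}` to the curve's own minimal degree only in the LOG-QUADRATIC form

  `T_log`: *there is `B` such that for every level `N`, every class-minimal datum `D`
  (`deg D = δ_{1,N}`) and every datum `D'` of a SEMISTABLE globally minimal elliptic `W'/ℚ` with
  the same newform which is of minimal degree among the data of `W'` itself,
  `log deg D' ≤ log deg D + B · N²`*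

(stated inline as a hypothesis, in the binder shape of `MazurKenkuBound` plus `W'.IsSemistable ℤ`).

* `logTransfer_of_mazurKenkuBound` — **`MazurKenkuBound ⟹ T_log`** with `B = log 163`
  (`N ≥ 1`), so `T_log` is at most as strong as the route item;
* `logMinModularDegree_le_of_logTransfer_of_semistableModularDatum` — **`T_log` + the semistable
  slice of modularity ⟹ the residual `R`** of
  `IsogenyGlueCongruenceSemistableHeightPolyBoundResidual` (`log(minModularDegree W N) ≤ A · N²`
  for `N ≥ N₂`, with `A = B + 1`), by the argument of
  `logMinModularDegree_le_of_mazurKenkuBound_of_semistableModularDatum` with `log 163` replaced by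
  `B · N²`: `log(min deg of W) ≤ log δ_{1,N} + B N² ≤ N log N + B N² ≤ (B + 1) N²`
  (`exists_log_modularDegree_le_mul_log`, i.e. Pasten's Thm 5.5 — the tree theorem
  `PastenShimura2024_thm_5_5_holds` — with the trivial Hecke bound);
* `semistableHeightPolyBound_of_logTransfer_of_modularDatumExists` — **`T_log → ModularDatumExists →
  SemistableHeightPolyBound`**, the same shape as the closed glue
  `SemistableHeightPolyBoundOfMazurKenku` (stmt-ABC-15128) with `MazurKenkuBound` weakened to
  `T_log`; and `semistableHeightPolyBoundOfMazurKenku_of_logTransfer_glue` — the closed glue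
  factors through it.

Why this matters for the route (planning-level; nothing here is unconditional progress on the
item): in print `T_log` holds WITHOUT Mazur's theorem on rational isogenies. Every
parametrisation of `W'` factors through the optimal curve `A` followed by a cyclic `ℚ`-isogeny
`ψ : A → W'` of degree `m`, and `deg D' = m · δ_{1,N}` for the composite datum (Néron mapping
property + integrality of the Manin constant of `A`, Edixhoven 1991 Prop 2 — the same auxiliary
inputs as for `MazurKenkuBound`); any bound `log m ≤ B · N²` suffices, and such bounds follow
(a) from Mazur–Kenku (`m ≤ 163`), or (b) from the Masser–Wüstholz isogeny estimate
`m ≤ c · max(1, h(A))⁴` (Invent. Math. 100 (1990), Main Theorem, naive height; over `ℚ` the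
naive height of a minimal model is `≪ 1 + h_F`) together with
`h_F(A) ≤ ½ log δ_{1,N} + 9 ≪ N log N` (Pasten 2024 §3 and Thm 7.2, in tree), giving even
`log m ≪ log N` — a transcendence estimate of the class the route already imports (Barriers
section: isogeny/period estimates, not linear forms in logarithms), with no Eisenstein ideal;
(c) for semistable classes Serre's dichotomy (Serre 1972 §5.4 Prop. 21; Mazur 1978, Intro.: a
`p`-isogeny of a semistable curve over `ℚ` has kernel `ℤ/p` or `μ_p`, so `p ∣ #Ẽ(𝔽_ℓ)` at a good
prime `ℓ ≠ p`) bounds the prime divisors of `m` by `O(log N)` elementarily.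
So the deciding theorem's hypothesis `hMK` may be replaced by `hT : T_log`
(`closes' … hT hMod … := hFrame hP (hSharp (hB (hGlueU hU hJ
(semistableHeightPolyBound_of_logTransfer_of_modularDatumExists hT hMod))))`), shrinking the
formal debt of the cone; the planner decides (D-0019). No definition, no named fact; helper for
item stmt-ABC-13918 (CONDITIONAL statements only).

## References

* [PastenShimura2024] H. Pasten, *Shimura curves and the abc conjecture*, J. Number Theory 254
  (2024) 214–335 = arXiv:1705.09251, §3 p. 13 (Mazur–Kenku transfer, (EqHDeg)), Thm 5.5, Thm 7.2.
* [Mazur1978] B. Mazur, *Rational isogenies of prime degree*, Invent. Math. 44 (1978), Thm 1 and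
  Introduction (semistable case via Serre).
* [Kenku1982] M. A. Kenku, J. Number Theory 15 (1982) 199–202.
* [MasserWustholz1990] D. Masser, G. Wüstholz, *Estimating isogenies on elliptic curves*,
  Invent. Math. 100 (1990) 1–24, Main Theorem.
* [Serre1972] J.-P. Serre, *Propriétés galoisiennes des points d'ordre fini des courbes
  elliptiques*, Invent. Math. 15 (1972), §5.4 Prop. 21 and its corollary (semistable curves).
* [MurtyPasten2013] M. R. Murty, H. Pasten, J. Number Theory 133 (2013), Thm 1.1.
-/

noncomputable section

-- `Summit.<Summit>.<Problem>` is the mandated summit-side namespace (CONVENTIONS §2); for the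
-- single-conjunct summit `ABC` the two coincide, so the duplicate `ABC.ABC` is deliberate.
set_option linter.dupNamespace false

namespace Summit.ABC.ABC.Theorems

open Literature.NumberTheory.EllipticCurves
open Literature.NumberTheory.EllipticCurves.ModularForms
open Literature.NumberTheory.EllipticCurves.Pasten2024
open Summit.ABC.ABC.Theses.IsogenyGlueCongruence

/-! ### `MazurKenkuBound ⟹ T_log` -/

/-- **The route item `MazurKenkuBound` implies the log-quadratic transfer `T_log`** with
`B = log 163`: from `deg D' ≤ 163 · deg D` (`D` class-minimal, `D'` minimal among the data of the
globally minimal `W'`) one gets `log deg D' ≤ log deg D + log 163 ≤ log deg D + log 163 · N²`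
(`N ≥ 1` from `[NeZero N]`); the semistability hypothesis of `T_log` is not used. So `T_log` is
at most as strong as stmt-ABC-15125 (Pasten 2024 §3 p. 13: Mazur 1978 + Kenku 1982).
[cite: PastenShimura2024, §3 p. 13] [cite: Mazur1978, Thm. 1] [cite: Kenku1982] -/
theorem logTransfer_of_mazurKenkuBound (hMK : MazurKenkuBound) :
    ∃ B : ℝ, ∀ (N : ℕ) [NeZero N] (W W' : WeierstrassCurve ℚ) [W.IsElliptic] [W'.IsElliptic]
      [W'.IsGloballyMinimal] (D : ModularParametrizationData W N)
      (D' : ModularParametrizationData W' N), D'.f = D.f →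
        (∀ (W'' : WeierstrassCurve ℚ) [W''.IsElliptic] (D'' : ModularParametrizationData W'' N),
            D''.f = D.f → D.modularDegree ≤ D''.modularDegree) →
          (∀ D'' : ModularParametrizationData W' N, D'.modularDegree ≤ D''.modularDegree) →
            W'.IsSemistable ℤ →
              Real.log (D'.modularDegree : ℝ) ≤
                Real.log (D.modularDegree : ℝ) + B * (N : ℝ) ^ 2 := by
  refine ⟨Real.log 163, fun N _ W W' _ _ _ D D' hf hmin hmin' _ => ?_⟩
  have hle : D'.modularDegree ≤ 163 * D.modularDegree := hMK N W W' D D' hf hmin hmin'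
  have hd : (0 : ℝ) < D.modularDegree := by exact_mod_cast D.deg_pos
  have hd' : (0 : ℝ) < D'.modularDegree := by exact_mod_cast D'.deg_pos
  have hlog : Real.log (D'.modularDegree : ℝ) ≤
      Real.log 163 + Real.log (D.modularDegree : ℝ) := by
    rw [← Real.log_mul (by norm_num) hd.ne']
    exact Real.log_le_log hd' (by exact_mod_cast hle)
  have hN1 : (1 : ℝ) ≤ (N : ℝ) := by exact_mod_cast Nat.one_le_iff_ne_zero.2 (NeZero.ne N)
  have hsq : (1 : ℝ) ≤ (N : ℝ) ^ 2 := by nlinarith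
  have h163 : (0 : ℝ) ≤ Real.log 163 := Real.log_nonneg (by norm_num)
  have h163' : Real.log 163 ≤ Real.log 163 * (N : ℝ) ^ 2 := by nlinarith
  linarith

/-! ### `T_log ⟹ R ⟹` the item -/

/-- **`T_log` and the semistable slice of modularity imply the residual `R`** (cf.
`logMinModularDegree_le_of_mazurKenkuBound_of_semistableModularDatum`, whose `log 163` is replaced
by `B · N²`): if every semistable globally minimal elliptic `W/ℚ` carries a datum at level `N_W`
and the log-quadratic transfer `T_log` holds with constant `B`, then for `N ≥ N₂`:
`log(minModularDegree W N) = log deg D' ≤ log δ_{1,N} + B N² ≤ N log N + max B 0 · N² ≤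
(max B 0 + 1) · N²`, where `D'` is a datum of `W` of minimal degree (`exists_minimal_datum`),
`δ_{1,N} = deg D₀` for a class-minimal datum with the same newform (`exists_minimal_datum_in_class`)
and `log δ_{1,N} ≤ N log N` for `N ≥ N₂` is `exists_log_modularDegree_le_mul_log` (Pasten's Thm 5.5,
the tree theorem `PastenShimura2024_thm_5_5_holds`, with the trivial Hecke bound). CONDITIONAL on
`T_log` and `hslice`. [cite: PastenShimura2024, §3 p. 13, Thm 5.5, Thm 7.2] -/
theorem logMinModularDegree_le_of_logTransfer_of_semistableModularDatum
    (hT : ∃ B : ℝ, ∀ (N : ℕ) [NeZero N] (W W' : WeierstrassCurve ℚ) [W.IsElliptic] [W'.IsElliptic]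
      [W'.IsGloballyMinimal] (D : ModularParametrizationData W N)
      (D' : ModularParametrizationData W' N), D'.f = D.f →
        (∀ (W'' : WeierstrassCurve ℚ) [W''.IsElliptic] (D'' : ModularParametrizationData W'' N),
            D''.f = D.f → D.modularDegree ≤ D''.modularDegree) →
          (∀ D'' : ModularParametrizationData W' N, D'.modularDegree ≤ D''.modularDegree) →
            W'.IsSemistable ℤ →
              Real.log (D'.modularDegree : ℝ) ≤
                Real.log (D.modularDegree : ℝ) + B * (N : ℝ) ^ 2)
    (hslice : ∀ (W : WeierstrassCurve ℚ) [W.IsElliptic] [W.IsGloballyMinimal]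
      [NeZero (W.conductorNorm ℤ)], W.IsSemistable ℤ →
        Nonempty (ModularParametrizationData W (W.conductorNorm ℤ))) :
    ∃ (A : ℝ) (N₂ : ℕ), ∀ (W : WeierstrassCurve ℚ) [W.IsElliptic] [W.IsGloballyMinimal]
      [NeZero (W.conductorNorm ℤ)], W.IsSemistable ℤ → N₂ ≤ W.conductorNorm ℤ →
        Nonempty (ModularParametrizationData W (W.conductorNorm ℤ)) ∧
          Real.log (minModularDegree W (W.conductorNorm ℤ) : ℝ) ≤
            A * (W.conductorNorm ℤ : ℝ) ^ 2 := by
  obtain ⟨B, hB⟩ := hT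
  obtain ⟨N₂, hN₂⟩ := exists_log_modularDegree_le_mul_log PastenShimura2024_thm_5_5_holds
  refine ⟨max B 0 + 1, N₂, fun W _ _ _ hss hN => ?_⟩
  have hW := hslice W hss
  refine ⟨hW, ?_⟩
  obtain ⟨D', hD'min, hD'le⟩ := exists_minimal_datum hW
  obtain ⟨W₀, hW₀, D₀, hf, hmin⟩ := exists_minimal_datum_in_class D'
  have hf' : D'.f = D₀.f := hf.symm
  have htr : Real.log (D'.modularDegree : ℝ) ≤
      Real.log (D₀.modularDegree : ℝ) + B * (W.conductorNorm ℤ : ℝ) ^ 2 :=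
    hB (W.conductorNorm ℤ) W₀ W D₀ D' hf' hmin hD'le hss
  have hδ := hN₂ (W.conductorNorm ℤ) W₀ D₀ hmin hN
  have hmineq : (minModularDegree W (W.conductorNorm ℤ) : ℝ) = D'.modularDegree := by
    exact_mod_cast hD'min.symm
  have hN1 : (1 : ℝ) ≤ (W.conductorNorm ℤ : ℝ) := by
    exact_mod_cast Nat.one_le_iff_ne_zero.2 (NeZero.ne _)
  have hNpos : (0 : ℝ) < (W.conductorNorm ℤ : ℝ) := by linarith
  have hsq0 : (0 : ℝ) ≤ (W.conductorNorm ℤ : ℝ) ^ 2 := by positivity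
  have hlogN : Real.log (W.conductorNorm ℤ : ℝ) ≤ (W.conductorNorm ℤ : ℝ) :=
    (Real.log_le_sub_one_of_pos hNpos).trans (by linarith)
  have hNN : (W.conductorNorm ℤ : ℝ) * Real.log (W.conductorNorm ℤ) ≤
      (W.conductorNorm ℤ : ℝ) ^ 2 := by
    rw [sq]
    exact mul_le_mul_of_nonneg_left hlogN hNpos.le
  have hBle : B * (W.conductorNorm ℤ : ℝ) ^ 2 ≤ max B 0 * (W.conductorNorm ℤ : ℝ) ^ 2 :=
    mul_le_mul_of_nonneg_right (le_max_left _ _) hsq0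
  calc Real.log (minModularDegree W (W.conductorNorm ℤ) : ℝ)
      = Real.log (D'.modularDegree : ℝ) := by rw [hmineq]
    _ ≤ Real.log (D₀.modularDegree : ℝ) + B * (W.conductorNorm ℤ : ℝ) ^ 2 := htr
    _ ≤ (W.conductorNorm ℤ : ℝ) * Real.log (W.conductorNorm ℤ) +
          max B 0 * (W.conductorNorm ℤ : ℝ) ^ 2 := by linarith
    _ ≤ (W.conductorNorm ℤ : ℝ) ^ 2 + max B 0 * (W.conductorNorm ℤ : ℝ) ^ 2 := by linarith
    _ = (max B 0 + 1) * (W.conductorNorm ℤ : ℝ) ^ 2 := by ring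

/-- **`T_log → ModularDatumExists → SemistableHeightPolyBound`**: the closed glue
`SemistableHeightPolyBoundOfMazurKenku` (stmt-ABC-15128) with `MazurKenkuBound` weakened to the
log-quadratic transfer `T_log` (`logMinModularDegree_le_of_logTransfer_of_semistableModularDatum`,
with the slice supplied by `ModularDatumExists` —
`DegreePrimesPolyBounded.semistableModularDatum_of_modularDatumExists` — followed by
`semistableHeightPolyBound_of_logMinModularDegree_le`, `R ⟹` item). The deciding theorem's
hypothesis `hMK` can therefore be replaced by `hT : T_log`. CONDITIONAL on `T_log` and the route
item `ModularDatumExists`. [cite: PastenShimura2024, §3 p. 13] [cite: MurtyPasten2013, Thm 1.1] -/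
theorem semistableHeightPolyBound_of_logTransfer_of_modularDatumExists
    (hT : ∃ B : ℝ, ∀ (N : ℕ) [NeZero N] (W W' : WeierstrassCurve ℚ) [W.IsElliptic] [W'.IsElliptic]
      [W'.IsGloballyMinimal] (D : ModularParametrizationData W N)
      (D' : ModularParametrizationData W' N), D'.f = D.f →
        (∀ (W'' : WeierstrassCurve ℚ) [W''.IsElliptic] (D'' : ModularParametrizationData W'' N),
            D''.f = D.f → D.modularDegree ≤ D''.modularDegree) →
          (∀ D'' : ModularParametrizationData W' N, D'.modularDegree ≤ D''.modularDegree) →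
            W'.IsSemistable ℤ →
              Real.log (D'.modularDegree : ℝ) ≤
                Real.log (D.modularDegree : ℝ) + B * (N : ℝ) ^ 2)
    (hmod : ModularDatumExists) : SemistableHeightPolyBound :=
  semistableHeightPolyBound_of_logMinModularDegree_le
    (logMinModularDegree_le_of_logTransfer_of_semistableModularDatum hT
      (DegreePrimesPolyBounded.semistableModularDatum_of_modularDatumExists hmod))

/-- **The closed glue factors through `T_log`**: `MazurKenkuBound → ModularDatumExists →
SemistableHeightPolyBound` (the statement of stmt-ABC-15128, i.e. the term `hHofMK` of `closes`)
obtained as `semistableHeightPolyBound_of_logTransfer_of_modularDatumExists ∘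
logTransfer_of_mazurKenkuBound`. [cite: PastenShimura2024, §3 p. 13] -/
theorem semistableHeightPolyBoundOfMazurKenku_of_logTransfer_glue :
    SemistableHeightPolyBoundOfMazurKenku := fun hMK hmod ↦
  semistableHeightPolyBound_of_logTransfer_of_modularDatumExists
    (logTransfer_of_mazurKenkuBound hMK) hmod

end Summit.ABC.ABC.Theorems

end
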